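import Summits.CriticalPhenomena.PercolationContinuityZ3.Theorems.PercNearOneGluingNoHeavyQuantAD3HeavyTop
import Summits.CriticalPhenomena.PercolationContinuityZ3.Theorems.PercNearOneGluingNoHeavyQuantSGCLightPairPairTools
import HarnessLib

/-!
# QUANT lane R8, T-DEC, ROUTE 2: the Fréchet laws of two LIGHT admissible pairs are admissible (cell `AD3FrechetCell`, kind L2⊗L2) —
# they have NO nonzero low atom

builds on p205010 (kernel theorem, internal audit signed; external expert review pending)

Support file (`--supports stmt-CriticalPhenomena-4575`), QUANT lane, seat prim-quant-arm-2 (gen 37), rung R8 of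
`run/shared/lean/prim/quant/LADDER.md`; third kernel piece of the lead g35 ruling "arm-2 owns `AD3FrechetCell`" (INBOX l.1198).
Theorems only, standard axioms, no sorries.

THE POINT.  An admissible LIGHT pair `{l, h; γ}` (`qγ < y`, its `q`-gate DEC at every layer `j′ < M`) has `q·T ≤ 2l` (typer g31's
`lightPair_two_lo_ge`).  Hence for two light admissible pairs `q(T₁ + T₂) ≤ 2(l₁ + l₂)`, and EVERY atom of either Fréchet law (`frCo`:
`l₁+l₂, l₁+h₂ | h₁+l₂, h₁+h₂`; `frCt`: `l₁+h₂, h₁+l₂, h₁+h₂` or `l₁+l₂, l₁+h₂, h₁+l₂`) is at least `l₁ + l₂`, so none of them is a low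
atom of the gated law: `decAt_all_of_noLow` (`…QuantAD3HeavyTop`) gives DEC at every layer.  (The kinds H⊗H and H⊗L2 are in
`…QuantAD3FrechetHH` / `…QuantAD3FrechetHL`.)

* `LawDec.triple_gate_decAt_of_noLow` — the `q`-gate of a three-atom law whose atoms all satisfy `q·T ≤ 2s` is DEC at every layer
  (`y·M ≤ q·T`, `0 < y < 1`, `0 ≤ q ≤ 1`).
* **`LawDec.frechet_gate_decAt_LL`** — for two light admissible top-affordable pairs, all four Fréchet shapes are admissible:
  `frCo` (`α ≤ β` and `β ≤ α` shapes), small `frCt`, big `frCt`.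
EXACT EVIDENCE (arm-2 g37 `code/frlight.py`): 8 712 L2⊗L2 Fréchet laws, all admissible, all with `2·(lowest atom) ≥ qT`; lead g35: 5 541 / 0.

[this work]; `lightPair_two_lo_ge`: prim-quant-stmt g31; Fréchet template: lead g35 (this lane).  The gluing rows served
[cite: KozmaNitzan2024, Conjecture 3 (p. 15)]; product measure [cite: Grimmett1999, §1.3 p. 10].
-/

noncomputable section

namespace Summit.CriticalPhenomena.PercolationContinuityZ3.Theorems

namespace Quant

open Finset

/-- two-point law notation `TP[lo, hi, g, h] = g·[h = hi] + (1 − g)·[h = lo]` (as in the lane's other files). -/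
local notation3 "TP[" lo ", " hi ", " g ", " h "]" =>
  (g : ℝ) * (if (h : ℕ) = (hi : ℕ) then (1 : ℝ) else 0) + (1 - (g : ℝ)) * (if (h : ℕ) = (lo : ℕ) then (1 : ℝ) else 0)

/-- three-atom law notation `TR[s₁, s₂, s₃, p₁, p₂, p₃, h] = p₁·[h = s₁] + p₂·[h = s₂] + p₃·[h = s₃]`. -/
local notation3 "TR[" s₁ ", " s₂ ", " s₃ ", " p₁ ", " p₂ ", " p₃ ", " h "]" =>
  (p₁ : ℝ) * (if (h : ℕ) = (s₁ : ℕ) then (1 : ℝ) else 0) + (p₂ : ℝ) * (if (h : ℕ) = (s₂ : ℕ) then (1 : ℝ) else 0)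
    + (p₃ : ℝ) * (if (h : ℕ) = (s₃ : ℕ) then (1 : ℝ) else 0)

namespace LawDec

/-- **the gate of a three-atom law with no low atom is DEC at every layer**: atoms `sᵢ ≤ M` with `q·T ≤ 2sᵢ`, masses `pᵢ ≥ 0`
summing to `1`, mean `T`, `0 ≤ q ≤ 1`, `0 < y < 1`, `y·M ≤ q·T`. [this work] -/
theorem triple_gate_decAt_of_noLow (y q T : ℝ) (M s₁ s₂ s₃ : ℕ) (p₁ p₂ p₃ : ℝ) (hy0 : 0 < y) (hy1 : y < 1)
    (hq0 : 0 ≤ q) (hq1 : q ≤ 1) (h1 : s₁ ≤ M) (h2 : s₂ ≤ M) (h3 : s₃ ≤ M) (hp₁ : 0 ≤ p₁) (hp₂ : 0 ≤ p₂) (hp₃ : 0 ≤ p₃)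
    (hp : p₁ + p₂ + p₃ = 1) (hT : p₁ * (s₁ : ℝ) + p₂ * (s₂ : ℝ) + p₃ * (s₃ : ℝ) = T) (hta : y * (M : ℝ) ≤ q * T)
    (hs₁ : q * T ≤ 2 * (s₁ : ℝ)) (hs₂ : q * T ≤ 2 * (s₂ : ℝ)) (hs₃ : q * T ≤ 2 * (s₃ : ℝ)) :
    ∀ j', j' < M → DECAt y j' M (gate (fun h => TR[s₁, s₂, s₃, p₁, p₂, p₃, h]) q) := by
  obtain ⟨t0, tM, t1, tmean⟩ := triple_laws' p₁ p₂ p₃ T M s₁ s₂ s₃ h1 h2 h3 hp₁ hp₂ hp₃ hp hT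
  obtain ⟨n0, nM, n1⟩ := gate_laws M (fun h => TR[s₁, s₂, s₃, p₁, p₂, p₃, h]) q hq0 hq1 t0 tM t1
  have nmean : ∑ h ∈ Finset.range (M + 1), (h : ℝ) * gate (fun h => TR[s₁, s₂, s₃, p₁, p₂, p₃, h]) q h = q * T := by
    rw [sum_mul_gate, tmean]
  refine decAt_all_of_noLow y M _ hy0 hy1 n0 nM n1 (by rw [nmean]; exact hta) fun h hh1 hpos => ?_
  rw [nmean]
  by_contra hlt
  rw [not_le] at hlt
  have hne1 : h ≠ s₁ := by rintro rfl; linarith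
  have hne2 : h ≠ s₂ := by rintro rfl; linarith
  have hne3 : h ≠ s₃ := by rintro rfl; linarith
  have : gate (fun h => TR[s₁, s₂, s₃, p₁, p₂, p₃, h]) q h = 0 := by
    simp only [gate]
    rw [if_neg hne1, if_neg hne2, if_neg hne3, if_neg (show h ≠ 0 by omega)]
    ring
  linarith

/-- **THE FRÉCHET LAWS OF TWO LIGHT ADMISSIBLE PAIRS ARE ADMISSIBLE (kind L2⊗L2 of `AD3FrechetCell`).**  Pairs `{lᵢ, hᵢ; γᵢ}`,
`lᵢ < hᵢ ≤ Mᵢ`, `0 ≤ γᵢ ≤ 1`, LIGHT (`qγᵢ < y`), top-affordable, with `q`-gates DEC at every layer `j′ < Mᵢ`; `0 < y < q ≤ 1`.  Then the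
`q`-gates of all four Fréchet shapes are DEC at every layer `j′ < M₁ + M₂`. [this work] -/
theorem frechet_gate_decAt_LL (y q α β : ℝ) (M₁ M₂ l₁ h₁ l₂ h₂ : ℕ) (hy0 : 0 < y) (hyq : y < q) (hq1 : q ≤ 1)
    (hl₁ : l₁ < h₁) (hh₁ : h₁ ≤ M₁) (hl₂ : l₂ < h₂) (hh₂ : h₂ ≤ M₂) (hα0 : 0 ≤ α) (hα1 : α ≤ 1) (hβ0 : 0 ≤ β) (hβ1 : β ≤ 1)
    (hαl : q * α < y) (hβl : q * β < y)
    (hta₁ : y * (M₁ : ℝ) ≤ q * ((l₁ : ℝ) + ((h₁ : ℝ) - l₁) * α)) (hta₂ : y * (M₂ : ℝ) ≤ q * ((l₂ : ℝ) + ((h₂ : ℝ) - l₂) * β))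
    (hD₁ : ∀ j', j' < M₁ → DECAt y j' M₁ (gate (fun h => TP[l₁, h₁, α, h]) q))
    (hD₂ : ∀ j', j' < M₂ → DECAt y j' M₂ (gate (fun h => TP[l₂, h₂, β, h]) q)) :
    (α ≤ β → ∀ j', j' < M₁ + M₂ →
        DECAt y j' (M₁ + M₂) (gate (fun h => TR[l₁ + l₂, l₁ + h₂, h₁ + h₂, 1 - β, β - α, α, h]) q)) ∧
    (β ≤ α → ∀ j', j' < M₁ + M₂ →
        DECAt y j' (M₁ + M₂) (gate (fun h => TR[l₁ + l₂, h₁ + l₂, h₁ + h₂, 1 - α, α - β, β, h]) q)) ∧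
    (α + β ≤ 1 → ∀ j', j' < M₁ + M₂ →
        DECAt y j' (M₁ + M₂) (gate (fun h => TR[l₁ + l₂, l₁ + h₂, h₁ + l₂, 1 - α - β, β, α, h]) q)) ∧
    (1 ≤ α + β → ∀ j', j' < M₁ + M₂ →
        DECAt y j' (M₁ + M₂) (gate (fun h => TR[l₁ + h₂, h₁ + l₂, h₁ + h₂, 1 - α, 1 - β, α + β - 1, h]) q)) := by
  have hq0 : 0 < q := lt_trans hy0 hyq
  have hy1 : y < 1 := lt_of_lt_of_le hyq hq1
  -- the light pairs have `q·Tᵢ ≤ 2lᵢ`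
  have h2l₁ := lightPair_two_lo_ge y q α M₁ l₁ h₁ hy1.le hl₁ hh₁ hα0 hα1 hαl hD₁
  have h2l₂ := lightPair_two_lo_ge y q β M₂ l₂ h₂ hy1.le hl₂ hh₂ hβ0 hβ1 hβl hD₂
  set T : ℝ := ((l₁ : ℝ) + ((h₁ : ℝ) - l₁) * α) + ((l₂ : ℝ) + ((h₂ : ℝ) - l₂) * β) with hT
  have hta : y * ((M₁ + M₂ : ℕ) : ℝ) ≤ q * T := by rw [hT]; push_cast; linarith
  have h2a : q * T ≤ 2 * ((l₁ + l₂ : ℕ) : ℝ) := by rw [hT]; push_cast; linarith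
  have hl₁' : (l₁ : ℝ) < h₁ := by exact_mod_cast hl₁
  have hl₂' : (l₂ : ℝ) < h₂ := by exact_mod_cast hl₂
  have e1 : ((l₁ + l₂ : ℕ) : ℝ) ≤ ((l₁ + h₂ : ℕ) : ℝ) := by push_cast; linarith
  have e2 : ((l₁ + l₂ : ℕ) : ℝ) ≤ ((h₁ + l₂ : ℕ) : ℝ) := by push_cast; linarith
  have e3 : ((l₁ + l₂ : ℕ) : ℝ) ≤ ((h₁ + h₂ : ℕ) : ℝ) := by push_cast; linarith
  refine ⟨fun hαβ => ?_, fun hβα => ?_, fun hsmall => ?_, fun hbig => ?_⟩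
  · exact triple_gate_decAt_of_noLow y q T (M₁ + M₂) _ _ _ _ _ _ hy0 hy1 hq0.le hq1 (by omega) (by omega) (by omega)
      (by linarith) (by linarith) hα0 (by ring) (by rw [hT]; push_cast; ring) hta h2a (by linarith) (by linarith)
  · exact triple_gate_decAt_of_noLow y q T (M₁ + M₂) _ _ _ _ _ _ hy0 hy1 hq0.le hq1 (by omega) (by omega) (by omega)
      (by linarith) (by linarith) hβ0 (by ring) (by rw [hT]; push_cast; ring) hta h2a (by linarith) (by linarith)
  · exact triple_gate_decAt_of_noLow y q T (M₁ + M₂) _ _ _ _ _ _ hy0 hy1 hq0.le hq1 (by omega) (by omega) (by omega)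
      (by linarith) hβ0 hα0 (by ring) (by rw [hT]; push_cast; ring) hta h2a (by linarith) (by linarith)
  · exact triple_gate_decAt_of_noLow y q T (M₁ + M₂) _ _ _ _ _ _ hy0 hy1 hq0.le hq1 (by omega) (by omega) (by omega)
      (by linarith) (by linarith) (by linarith) (by ring) (by rw [hT]; push_cast; ring) hta (by linarith) (by linarith)
      (by linarith)

end LawDec

end Quant

end Summit.CriticalPhenomena.PercolationContinuityZ3.Theorems
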